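import Summits.QuantumFields.YangMills.Theorems.UnitScaleTiltProp7CovRightInverse
import Summits.QuantumFields.YangMills.Theorems.UnitScaleTiltProp7FirstVariationCurrent
import Summits.QuantumFields.YangMills.Theorems.UnitScaleTiltProp7GrowthAssemblySU
import HarnessLib

/-!
# Route `UnitScaleTilt`, crux K1 child «MinimiserStabilityRegPr» (stmt-QuantumFields-19200), registered stub `stub_prop7From14` (leaf V3 «Prop 7 from a
# background (14)») — **THE MODEL GROWTH THEOREM WITH ONLY `𝔰𝔲(2)`-CRITICALITY ASSUMED**: at a configuration `U₀` of print's regular space (6) (both clauses,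
# `4·10⁵ε₀ ≤ 1`) at which the first variation vanishes on the `𝔰𝔲(2)`-valued kernel of the linearised model average, every model-fibre secant `U = (1+Y)U₀` in
# covariant Landau gauge within the chart scale obeys `(1/1200)·L^{−2(K−n)}·Σ_b‖Y(b)‖² ≤ A(U) − A(U₀)`

Cell `ym3-torus` ∕ fleet seat `ym-ust-19200-p1` (gen 5).  The inputs of the `ℓ²` assembly spine `Prop7GrowthAssembly.growth_of_growthModLin_proj` (p(GrowthAssemblySU),
criticality on `𝔰𝔲(2)`-valued fields only) at the model constraint are theorems of the lineage: growth modulo the linear term (p521440), the second-order fibre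
defect (p520587), the right inverse with `ℓ¹` bound `2L^{−(K−n)}` (`Prop7CovRightInverse.exists_rightInverse_modelAvg`, p531168, at `12ε ≤ 1`), the current bound
`|Lin_{U₀}(Z)| ≤ ε₀L^{−3(K−n)}Σ‖Z‖` from print's divergence clause (`Prop7FirstVariationCurrent.abs_lin_le_of_divSmall_T3`, p529186), the `ℓ¹ → ℓ¹` bound
`Σ_c‖T_{U₀}Z(c)‖ ≤ 2L^{K−n}Σ‖Z‖` (this file, tent count), the commutation of `T_{U₀}` with the `𝔰𝔲(2)` projection (unitary conjugations) and the second-order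
Hermitian part of a secant (`norm_sub_proj_le_of_su2`).  This file draws the conclusion at the d = 3 `SU(2)` carrier.

WHAT IS PROVED (sorry-free, no definition): `exists_rightInverse_modelAvg_T3` (d = 3 carrier of the right inverse, `B = 2`); `sum_sum_norm_line_le` ∕ `sum_pair_norm_eq` ∕
`sum_norm_modelAvg_le` (the `ℓ¹ → ℓ¹` bound); `modelAvg_proj_comm`; **`wilsonAction4_sub_background_ge_of_suCritical_regPr_T3`** (the title).

HONEST SCOPE.  MODEL constraint (straight contours, comb transports from the block corner); full covariant Landau gauge (print's slice (21) is `R(U₀)D^*A = 0`);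
`𝔰𝔲(2)`-criticality for the MODEL constraint as hypothesis (an R2-critical configuration of the item is critical for the (0.4) average of record — p2 lineage
`Prop8Criticality` — not for the model constraint).  What is kernel-checked is the MECHANISM of [Balaban1985Variational] Prop. 7's uniqueness clause with absolute
constants.  Nothing of Bałaban's is asserted.

References: T. Bałaban, CMP 102 (1985) 277–309 [Balaban1985Variational] ((6) p.278, (19)–(21) p.281, (45)–(46) p.285, (127) p.297, (141)–(143) p.299, (152) p.300).
-/

noncomputable section

open scoped BigOperators Matrix.Norms.L2Operator Matrix

namespace Summit.QuantumFields.YangMills.Theorems.Prop7ModelGrowth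

open Literature.MathematicalPhysics.QuantumFieldTheory.Balaban1983to89
open Finset B1RG242Torus LatticeFieldCalculus T3ContinuumYM3Torus T3PrintedRegularMinimiser
open B7Prop1Explicit (U1 treeWord)
open B7Eq78Linearization (conjR)
open B8Ineq132 (norm_conjR)
open B9Eq39Adjoint (divB)
open B9TorusCalculus (torusT)
open B10Eq27TorusAxialLog (holT unitsField toUField val_holT_unitsField)
open B10StarCount (sum_pbond)
open Summit.QuantumFields.YangMills.Theorems.Prop7CovariantCoercivity (hyp_of_specialUnitary holT_mem)
open Summit.QuantumFields.YangMills.Theorems.Prop7FlatCoercivity (iterate_shift_eq_runSite)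
open Summit.QuantumFields.YangMills.Theorems.Prop7LineAvgRightInverse (sum_offsets_sum_range_runSite sum_pbond_runSite_one sum_dir_site_eq sum_pbond_fine_eq)
open Summit.QuantumFields.YangMills.Theorems.Prop7CovRightInverse (exists_rightInverse_modelAvg)
open Summit.QuantumFields.YangMills.Theorems.Prop7GrowthAssembly (growth_of_growthModLin_proj proj_sub proj_sum proj_proj norm_proj_le proj_conj_unitary
  norm_sub_proj_le_of_su2)
open Summit.QuantumFields.YangMills.Theorems.Prop7CovLineAvgTaylor (norm_covLineSum_le_of_modelFibre sum_sum_normSq_line_le sum_pair_normSq_eq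
  wilsonAction4_sub_background_ge_of_modelFibre_T3)
open Summit.QuantumFields.YangMills.Theorems.Prop7FirstVariationCurrent (abs_lin_le_of_divSmall_T3)
open Summit.QuantumFields.YangMills.Theorems.Prop8Criticality (linPlaq_sub_smul)

/-! ## §1 The right inverse at the d = 3 carrier -/

/-- **THE RIGHT INVERSE AT THE d = 3 `SU(2)` CARRIER**: background `U₀` of run `K` with `dist1(U₀(∂p)) ≤ εL^{−2(K−n)}`, `12ε ≤ 1` (so `θ = 6ε ≤ ½`): a right
inverse `H` of the linearised model average `T_{U₀}` with `Σ_b‖HW(b)‖ ≤ 2·L^{−(K−n)}·Σ_c‖W(c)‖`. [cite: Balaban1985Variational, (45)-(46) p.285] -/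
theorem exists_rightInverse_modelAvg_T3 (F : T3Family) (n K : ℕ) (U₀ : GaugeField (F.P K) 0 (Matrix.specialUnitaryGroup (Fin 2) ℂ))
    {ε : ℝ} (hε : 0 ≤ ε) (hε12 : 12 * ε ≤ 1)
    (hU₀ : ∀ p : Plaq (F.P K) 0, dist1 (GaugeField.plaqHol U₀ p) ≤ ε * (((F.L : ℝ) ^ (K - n)) ^ 2)⁻¹)
    (T : (PBond (F.P K) 0 → Matrix (Fin 2) (Fin 2) ℂ) → PBond (F.P K) (K - n) → Matrix (Fin 2) (Fin 2) ℂ)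
    (hT : ∀ Z c, T Z c = ∑ r : Fin (F.P K).d → Fin ((F.P K).L ^ (K - n)), ∑ t : Fin ((F.P K).L ^ (K - n)),
        conjR (holT (unitsField (toUField U₀)) (Site.fibreSite 0 (K - n) c.src fun _ => ⟨0, pow_pos (F.P K).L_pos (K - n)⟩)
              (treeWord fun ν => ((r ν : ℕ) : ℤ))
            * holT (unitsField (toUField U₀)) (Site.fibreSite 0 (K - n) c.src r) (List.replicate (t : ℕ) (c.dir, true)))
          (Z ⟨(fun z : Site (F.P K) 0 => z.shift c.dir)^[(t : ℕ)] (Site.fibreSite 0 (K - n) c.src r), c.dir⟩)) :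
    ∃ H : (PBond (F.P K) (K - n) → Matrix (Fin 2) (Fin 2) ℂ) → PBond (F.P K) 0 → Matrix (Fin 2) (Fin 2) ℂ,
      (∀ W, T (H W) = W) ∧ ∀ W, ∑ b, ‖H W b‖ ≤ 2 * ((F.L : ℝ) ^ (K - n))⁻¹ * ∑ c, ‖W c‖ := by
  obtain ⟨hV₀, hplaq⟩ := hyp_of_specialUnitary U₀ hU₀
  have hLF : ((F.P K).L : ℝ) = (F.L : ℝ) := by norm_cast
  have hd : ((F.P K).d : ℝ) = 3 := by norm_num [T3Family.P_d]
  have hn0 : (0 : ℝ) < (F.L : ℝ) ^ (K - n) := by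
    have : (0 : ℝ) < F.L := by have := F.hL.2; exact_mod_cast (by omega : 0 < F.L)
    positivity
  have ha0 : 0 ≤ ε * (((F.L : ℝ) ^ (K - n)) ^ 2)⁻¹ := by positivity
  have hθeq : ((F.P K).L : ℝ) ^ (K - n) * (2 * (((F.P K).d : ℝ) * ((F.P K).L : ℝ) ^ (K - n) * (ε * (((F.L : ℝ) ^ (K - n)) ^ 2)⁻¹))) = 6 * ε := by
    rw [hLF, hd]; field_simp; ring
  have hθ : ((F.P K).L : ℝ) ^ (K - n) * (2 * (((F.P K).d : ℝ) * ((F.P K).L : ℝ) ^ (K - n) * (ε * (((F.L : ℝ) ^ (K - n)) ^ 2)⁻¹))) < 1 := by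
    rw [hθeq]; linarith
  obtain ⟨H, hTH, hH⟩ := exists_rightInverse_modelAvg (Prop7FlatCoercivity.sitesPerDir_T3 F n K) hV₀ ha0 hplaq hθ T hT
  refine ⟨H, hTH, fun W => (hH W).trans (mul_le_mul_of_nonneg_right ?_ (Finset.sum_nonneg fun _ _ => norm_nonneg _))⟩
  rw [hθeq, hLF]
  have hS : (0 : ℝ) < 1 - 6 * ε := by linarith
  rw [mul_inv, mul_comm]
  refine mul_le_mul_of_nonneg_right ?_ (inv_nonneg.mpr hn0.le)
  rw [inv_le_comm₀ hS (by norm_num : (0 : ℝ) < 2)]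
  linarith

/-! ## §2 The `ℓ¹ → ℓ¹` bound of the linearised model average -/

variable {P : Params} {k : ℕ}

/-- Tent count of an `ℓ¹` mass along the contours of a block (each bond is visited at most `L^k` times). [folklore] -/
theorem sum_sum_norm_line_le {𝔸 : Type*} [NormedRing 𝔸] (h : P.sitesPerDir 0 = P.L ^ k * P.sitesPerDir k) (Y : PBond P 0 → 𝔸) (y : Site P k) (μ : Fin P.d) :
    ∑ r : Fin P.d → Fin (P.L ^ k), ∑ t : Fin (P.L ^ k), ‖Y ⟨(fun z : Site P 0 => z.shift μ)^[(t : ℕ)] (Site.fibreSite 0 k y r), μ⟩‖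
      ≤ (P.L : ℝ) ^ k * (∑ r : Fin P.d → Fin (P.L ^ k), ‖Y ⟨Site.fibreSite 0 k y r, μ⟩‖
          + ∑ r : Fin P.d → Fin (P.L ^ k), ‖Y ⟨Site.fibreSite 0 k (runSite y μ 1) r, μ⟩‖) := by
  have hcount := sum_offsets_sum_range_runSite μ h y (fun z => ‖Y ⟨z, μ⟩‖)
  simp only [iterate_shift_eq_runSite]
  rw [show (∑ r : Fin P.d → Fin (P.L ^ k), ∑ t : Fin (P.L ^ k), ‖Y ⟨runSite (Site.fibreSite 0 k y r) μ (t : ℕ), μ⟩‖)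
      = ∑ r : Fin P.d → Fin (P.L ^ k), ∑ t ∈ range (P.L ^ k), ‖Y ⟨runSite (Site.fibreSite 0 k y r) μ t, μ⟩‖ from
      Finset.sum_congr rfl fun r _ => (Finset.sum_range (fun t => ‖Y ⟨runSite (Site.fibreSite 0 k y r) μ t, μ⟩‖)).symm, hcount]
  simp only [nsmul_eq_mul]
  rw [mul_add, Finset.mul_sum, Finset.mul_sum]
  have hN : ∀ r : Fin P.d → Fin (P.L ^ k), (((r μ : ℕ) + 1 : ℕ) : ℝ) ≤ (P.L : ℝ) ^ k := fun r => by
    have : (((r μ : ℕ) + 1 : ℕ) : ℝ) ≤ ((P.L ^ k : ℕ) : ℝ) := by exact_mod_cast (r μ).isLt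
    push_cast at this ⊢; exact this
  have hN' : ∀ r : Fin P.d → Fin (P.L ^ k), ((P.L ^ k - 1 - (r μ : ℕ) : ℕ) : ℝ) ≤ (P.L : ℝ) ^ k := fun r => by
    have : ((P.L ^ k - 1 - (r μ : ℕ) : ℕ) : ℝ) ≤ ((P.L ^ k : ℕ) : ℝ) := by exact_mod_cast (by omega)
    push_cast at this; exact this
  refine add_le_add (Finset.sum_le_sum fun r _ => ?_) (Finset.sum_le_sum fun r _ => ?_)
  · push_cast
    exact mul_le_mul_of_nonneg_right (by have := hN r; push_cast at this; exact this) (norm_nonneg _)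
  · exact mul_le_mul_of_nonneg_right (hN' r) (norm_nonneg _)

/-- The two-block `ℓ¹` masses summed over the coarse bonds give twice the total mass. [folklore] -/
theorem sum_pair_norm_eq {𝔸 : Type*} [NormedRing 𝔸] (h : P.sitesPerDir 0 = P.L ^ k * P.sitesPerDir k) (Y : PBond P 0 → 𝔸) :
    ∑ c : PBond P k, (∑ r : Fin P.d → Fin (P.L ^ k), ‖Y ⟨Site.fibreSite 0 k c.src r, c.dir⟩‖
        + ∑ r : Fin P.d → Fin (P.L ^ k), ‖Y ⟨Site.fibreSite 0 k (runSite c.src c.dir 1) r, c.dir⟩‖)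
      = 2 * ∑ b : PBond P 0, ‖Y b‖ := by
  rw [Finset.sum_add_distrib, sum_pbond_runSite_one (fun c : PBond P k => ∑ r : Fin P.d → Fin (P.L ^ k), ‖Y ⟨Site.fibreSite 0 k c.src r, c.dir⟩‖),
    ← sum_dir_site_eq (fun c : PBond P k => ∑ r : Fin P.d → Fin (P.L ^ k), ‖Y ⟨Site.fibreSite 0 k c.src r, c.dir⟩‖),
    ← sum_pbond_fine_eq h (fun b => ‖Y b‖)]
  ring

variable {N : ℕ}

/-- **THE `ℓ¹ → ℓ¹` BOUND OF THE LINEARISED MODEL AVERAGE**: `Σ_c‖T_V Z(c)‖ ≤ 2L^k·Σ_b‖Z(b)‖` for a unitary background (conjugations are isometries; tent count).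
[folklore] -/
theorem sum_norm_modelAvg_le [NeZero N] (h : P.sitesPerDir 0 = P.L ^ k * P.sitesPerDir k) {V : GaugeField P 0 (Matrix (Fin N) (Fin N) ℂ)ˣ}
    (hV : ∀ b, V b ∈ U1 (Matrix (Fin N) (Fin N) ℂ))
    (T : (PBond P 0 → Matrix (Fin N) (Fin N) ℂ) → PBond P k → Matrix (Fin N) (Fin N) ℂ)
    (hT : ∀ Z c, T Z c = ∑ r : Fin P.d → Fin (P.L ^ k), ∑ t : Fin (P.L ^ k),
        conjR (holT V (Site.fibreSite 0 k c.src fun _ => ⟨0, pow_pos P.L_pos k⟩) (treeWord fun ν => ((r ν : ℕ) : ℤ))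
            * holT V (Site.fibreSite 0 k c.src r) (List.replicate (t : ℕ) (c.dir, true)))
          (Z ⟨(fun z : Site P 0 => z.shift c.dir)^[(t : ℕ)] (Site.fibreSite 0 k c.src r), c.dir⟩))
    (Z : PBond P 0 → Matrix (Fin N) (Fin N) ℂ) :
    ∑ c, ‖T Z c‖ ≤ 2 * (P.L : ℝ) ^ k * ∑ b, ‖Z b‖ := by
  have hc : ∀ c : PBond P k, ‖T Z c‖ ≤ (P.L : ℝ) ^ k * (∑ r : Fin P.d → Fin (P.L ^ k), ‖Z ⟨Site.fibreSite 0 k c.src r, c.dir⟩‖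
      + ∑ r : Fin P.d → Fin (P.L ^ k), ‖Z ⟨Site.fibreSite 0 k (runSite c.src c.dir 1) r, c.dir⟩‖) := by
    intro c
    rw [hT]
    refine (norm_sum_le _ _).trans (((Finset.sum_le_sum fun r _ => norm_sum_le _ _)).trans ?_)
    refine le_trans (le_of_eq (Finset.sum_congr rfl fun r _ => Finset.sum_congr rfl fun t _ =>
      norm_conjR ((U1 _).mul_mem (holT_mem hV _ _) (holT_mem hV _ _)) _)) ?_
    exact sum_sum_norm_line_le h Z c.src c.dir
  refine (Finset.sum_le_sum fun c _ => hc c).trans ?_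
  rw [← Finset.mul_sum, sum_pair_norm_eq h Z]
  ring_nf
  rfl

/-! ## §3 The linearised model average commutes with the `𝔰𝔲(2)` projection -/

/-- The transports of the `M_N(ℂ)`-units reading of an `SU(N)` configuration are unitary matrices. [folklore] -/
theorem coe_holT_unitsField_mem_unitaryGroup (U₀ : GaugeField P 0 (Matrix.specialUnitaryGroup (Fin N) ℂ)) (x : Site P 0) (w : List (B7Prop1Explicit.Letter P.d)) :
    ((holT (unitsField (toUField U₀)) x w : (Matrix (Fin N) (Fin N) ℂ)ˣ) : Matrix (Fin N) (Fin N) ℂ) ∈ Matrix.unitaryGroup (Fin N) ℂ := by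
  rw [val_holT_unitsField]
  exact (holT (toUField U₀) x w).2

/-- Conjugation by a unit whose matrix is unitary is `X ↦ uXu^*`. [folklore] -/
theorem conjR_eq_mul_mul_star {u : (Matrix (Fin N) (Fin N) ℂ)ˣ} (hu : (u : Matrix (Fin N) (Fin N) ℂ) ∈ Matrix.unitaryGroup (Fin N) ℂ)
    (X : Matrix (Fin N) (Fin N) ℂ) : conjR u X = (u : Matrix (Fin N) (Fin N) ℂ) * X * star (u : Matrix (Fin N) (Fin N) ℂ) := by
  rw [B7Eq78Linearization.conjR_apply, Units.inv_eq_of_mul_eq_one_right (Matrix.mem_unitaryGroup_iff.mp hu)]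

/-- **THE LINEARISED MODEL AVERAGE COMMUTES WITH THE `𝔰𝔲(2)` PROJECTION** (its transports are unitary conjugations, which commute with `X ↦ ½(X − X^*)` and preserve
the trace). [folklore] -/
theorem modelAvg_proj_comm (U₀ : GaugeField P 0 (Matrix.specialUnitaryGroup (Fin 2) ℂ))
    (T : (PBond P 0 → Matrix (Fin 2) (Fin 2) ℂ) → PBond P k → Matrix (Fin 2) (Fin 2) ℂ)
    (hT : ∀ Z c, T Z c = ∑ r : Fin P.d → Fin (P.L ^ k), ∑ t : Fin (P.L ^ k),
        conjR (holT (unitsField (toUField U₀)) (Site.fibreSite 0 k c.src fun _ => ⟨0, pow_pos P.L_pos k⟩) (treeWord fun ν => ((r ν : ℕ) : ℤ))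
            * holT (unitsField (toUField U₀)) (Site.fibreSite 0 k c.src r) (List.replicate (t : ℕ) (c.dir, true)))
          (Z ⟨(fun z : Site P 0 => z.shift c.dir)^[(t : ℕ)] (Site.fibreSite 0 k c.src r), c.dir⟩))
    (Z : PBond P 0 → Matrix (Fin 2) (Fin 2) ℂ) :
    T (fun b => (1 / 2 : ℂ) • (Z b - (Z b)ᴴ) - ((((1 / 2 : ℂ) • (Z b - (Z b)ᴴ)).trace / 2) • (1 : Matrix (Fin 2) (Fin 2) ℂ)))
      = fun c => (1 / 2 : ℂ) • (T Z c - (T Z c)ᴴ) - ((((1 / 2 : ℂ) • (T Z c - (T Z c)ᴴ)).trace / 2) • (1 : Matrix (Fin 2) (Fin 2) ℂ)) := by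
  funext c
  rw [hT, hT, proj_sum]
  refine Finset.sum_congr rfl fun r _ => ?_
  rw [proj_sum]
  refine Finset.sum_congr rfl fun t _ => ?_
  have hu : ((holT (unitsField (toUField U₀)) (Site.fibreSite 0 k c.src fun _ => ⟨0, pow_pos P.L_pos k⟩) (treeWord fun ν => ((r ν : ℕ) : ℤ))
        * holT (unitsField (toUField U₀)) (Site.fibreSite 0 k c.src r) (List.replicate (t : ℕ) (c.dir, true)) : (Matrix (Fin 2) (Fin 2) ℂ)ˣ) :
          Matrix (Fin 2) (Fin 2) ℂ) ∈ Matrix.unitaryGroup (Fin 2) ℂ := by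
    rw [Units.val_mul]
    exact Submonoid.mul_mem _ (coe_holT_unitsField_mem_unitaryGroup U₀ _ _) (coe_holT_unitsField_mem_unitaryGroup U₀ _ _)
  rw [conjR_eq_mul_mul_star hu, conjR_eq_mul_mul_star hu, proj_conj_unitary hu]

/-! ## §4 The model growth theorem -/

/-- **STRICT QUADRATIC GROWTH ON THE MODEL FIBRE, ONLY `𝔰𝔲(2)`-CRITICALITY ASSUMED, d = 3 CARRIER.**  `U₀ ∈ 𝔘_k(ε₀)` in full (`RegPr F n K ε₀ U₀`), `4·10⁵ε₀ ≤ 1`;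
`Y = UU₀^* − 1` with `2000L^{K−n}max‖Y‖ ≤ 1`, covariant Landau gauge, `U` on the model averaging fibre of `U₀`; `Λ = Lin_{U₀}` (verbatim p482559/p521440) vanishes on
the TRACELESS ANTI-HERMITIAN fields in the kernel of the linearised model average `T_{U₀}` (the Euler–Lagrange input a critical point of the model problem supplies).
Then `(1/1200)·L^{−2(K−n)}·Σ_b‖Y(b)‖² ≤ A(U) − A(U₀)`. [cite: Balaban1985Variational, (6) p.278, (127) p.297, (141)-(143) p.299, (152) p.300] -/
theorem wilsonAction4_sub_background_ge_of_suCritical_regPr_T3 (F : T3Family) (n K : ℕ)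
    (U U₀ : GaugeField (F.P K) 0 (Matrix.specialUnitaryGroup (Fin 2) ℂ)) (Y : PBond (F.P K) 0 → Matrix (Fin 2) (Fin 2) ℂ)
    (hYU : ∀ b : PBond (F.P K) 0, Y b = (U b : Matrix (Fin 2) (Fin 2) ℂ) * star (U₀ b : Matrix (Fin 2) (Fin 2) ℂ) - 1)
    {ε₀ δ : ℝ} (hε₀ : 0 ≤ ε₀) (hε₀1 : 400000 * ε₀ ≤ 1) (hreg : RegPr F n K ε₀ U₀)
    (hδ : ∀ b : PBond (F.P K) 0, ‖Y b‖ ≤ δ) (hδn : 2000 * (F.L : ℝ) ^ (K - n) * δ ≤ 1)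
    (hdiv : ∀ x : Site (F.P K) 0, divB (torusT (F.P K) 0) (fun κ z => unitsField (toUField U₀) ⟨z, κ⟩) (fun κ z => Y ⟨z, κ⟩) x = 0)
    (hfib : ∀ c : PBond (F.P K) (K - n), ∑ r : Fin (F.P K).d → Fin ((F.P K).L ^ (K - n)),
      conjR (holT (unitsField (toUField U₀)) (Site.fibreSite 0 (K - n) c.src fun _ => ⟨0, pow_pos (F.P K).L_pos (K - n)⟩)
              (treeWord fun ν => ((r ν : ℕ) : ℤ)))
        (((holT (unitsField (toUField U)) (Site.fibreSite 0 (K - n) c.src r) (List.replicate ((F.P K).L ^ (K - n)) (c.dir, true))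
              : (Matrix (Fin 2) (Fin 2) ℂ)ˣ) : Matrix (Fin 2) (Fin 2) ℂ)
          * (((holT (unitsField (toUField U₀)) (Site.fibreSite 0 (K - n) c.src r) (List.replicate ((F.P K).L ^ (K - n)) (c.dir, true)))⁻¹
              : (Matrix (Fin 2) (Fin 2) ℂ)ˣ) : Matrix (Fin 2) (Fin 2) ℂ) - 1) = 0)
    (Λ : (PBond (F.P K) 0 → Matrix (Fin 2) (Fin 2) ℂ) → ℝ)
    (hΛ : ∀ Z, Λ Z = ∑ p : Plaq (F.P K) 0, (1 / 2) * ((((((GaugeField.plaqHol U₀ p : Matrix.specialUnitaryGroup (Fin 2) ℂ) : Matrix (Fin 2) (Fin 2) ℂ)) - 1)ᴴ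
          * ((Z ⟨p.src, p.μ⟩
              + (U₀ ⟨p.src, p.μ⟩ : Matrix (Fin 2) (Fin 2) ℂ) * Z ⟨p.src.shift p.μ, p.ν⟩ * star (U₀ ⟨p.src, p.μ⟩ : Matrix (Fin 2) (Fin 2) ℂ)
              - ((U₀ ⟨p.src, p.μ⟩ * U₀ ⟨p.src.shift p.μ, p.ν⟩ * (U₀ ⟨p.src.shift p.ν, p.μ⟩)⁻¹ : Matrix.specialUnitaryGroup (Fin 2) ℂ) : Matrix (Fin 2) (Fin 2) ℂ)
                  * Z ⟨p.src.shift p.ν, p.μ⟩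
                  * star ((U₀ ⟨p.src, p.μ⟩ * U₀ ⟨p.src.shift p.μ, p.ν⟩ * (U₀ ⟨p.src.shift p.ν, p.μ⟩)⁻¹ : Matrix.specialUnitaryGroup (Fin 2) ℂ) : Matrix (Fin 2) (Fin 2) ℂ)
              - ((GaugeField.plaqHol U₀ p : Matrix.specialUnitaryGroup (Fin 2) ℂ) : Matrix (Fin 2) (Fin 2) ℂ) * Z ⟨p.src, p.ν⟩
                  * star ((GaugeField.plaqHol U₀ p : Matrix.specialUnitaryGroup (Fin 2) ℂ) : Matrix (Fin 2) (Fin 2) ℂ))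
            * ((GaugeField.plaqHol U₀ p : Matrix.specialUnitaryGroup (Fin 2) ℂ) : Matrix (Fin 2) (Fin 2) ℂ))).trace).re)
    (T : (PBond (F.P K) 0 → Matrix (Fin 2) (Fin 2) ℂ) → PBond (F.P K) (K - n) → Matrix (Fin 2) (Fin 2) ℂ)
    (hT : ∀ Z c, T Z c = ∑ r : Fin (F.P K).d → Fin ((F.P K).L ^ (K - n)), ∑ t : Fin ((F.P K).L ^ (K - n)),
        conjR (holT (unitsField (toUField U₀)) (Site.fibreSite 0 (K - n) c.src fun _ => ⟨0, pow_pos (F.P K).L_pos (K - n)⟩)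
              (treeWord fun ν => ((r ν : ℕ) : ℤ))
            * holT (unitsField (toUField U₀)) (Site.fibreSite 0 (K - n) c.src r) (List.replicate (t : ℕ) (c.dir, true)))
          (Z ⟨(fun z : Site (F.P K) 0 => z.shift c.dir)^[(t : ℕ)] (Site.fibreSite 0 (K - n) c.src r), c.dir⟩))
    -- `𝔰𝔲(2)`-criticality for the model constraint
    (hEL : ∀ Z, (∀ b, (Z b)ᴴ = -Z b ∧ (Z b).trace = 0) → T Z = 0 → Λ Z = 0) :
    (1 / 1200) * (((F.L : ℝ) ^ (K - n)) ^ 2)⁻¹ * ∑ b : PBond (F.P K) 0, ‖Y b‖ ^ 2 ≤ wilsonAction4 U - wilsonAction4 U₀ := by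
  -- (0) scalars
  have hn0 : (0 : ℝ) < (F.L : ℝ) ^ (K - n) := by
    have : (0 : ℝ) < F.L := by have := F.hL.2; exact_mod_cast (by omega : 0 < F.L)
    positivity
  have hn1 : (1 : ℝ) ≤ (F.L : ℝ) ^ (K - n) := one_le_pow₀ (by have := F.hL.2; exact_mod_cast (by omega : 1 ≤ F.L))
  have hδ0 : 0 ≤ δ := (norm_nonneg _).trans (hδ ⟨fun _ => 0, ⟨0, (F.P K).hd⟩⟩)
  have hLF : ((F.P K).L : ℝ) = (F.L : ℝ) := by norm_cast
  have hsites := Prop7FlatCoercivity.sitesPerDir_T3 F n K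
  -- the plaquette clause of `RegPr`, in the `≤ ε·(L^{K−n})^{−2}` form
  have hU₀ : ∀ p : Plaq (F.P K) 0, dist1 (GaugeField.plaqHol U₀ p) ≤ ε₀ * (((F.L : ℝ) ^ (K - n)) ^ 2)⁻¹ := by
    intro p
    have h1 := (hreg.plaqSmall p).le
    have h2 : T3RegularMinimiser.regThreshold F n K ε₀ = ε₀ * (((F.L : ℝ) ^ (K - n)) ^ 2)⁻¹ := by
      rw [T3RegularMinimiser.regThreshold, inv_pow, mul_comm 2 (K - n), pow_mul]
    rwa [h2] at h1
  obtain ⟨hV₀, -⟩ := hyp_of_specialUnitary U₀ hU₀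
  -- (1) growth modulo the linear term
  have hG := wilsonAction4_sub_background_ge_of_modelFibre_T3 F n K U U₀ Y hYU hε₀ hε₀1 hU₀ hδ hδn hdiv hfib
  rw [← hΛ Y] at hG
  -- (2) `Λ`, `T` respect differences
  have hΛsub : ∀ Z Z', Λ (Z - Z') = Λ Z - Λ Z' := by
    intro Z Z'
    rw [hΛ, hΛ, hΛ, ← Finset.sum_sub_distrib]
    refine Finset.sum_congr rfl fun p _ => ?_
    have h := linPlaq_sub_smul U₀ Z Z' 1 p
    simp only [Complex.ofReal_one, one_smul, one_mul] at h
    simp only [Pi.sub_apply]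
    exact h.symm
  have hTsub : ∀ Z Z', T (Z - Z') = T Z - T Z' := by
    intro Z Z'
    funext c
    rw [Pi.sub_apply, hT, hT, hT, ← Finset.sum_sub_distrib]
    refine Finset.sum_congr rfl fun r _ => ?_
    rw [← Finset.sum_sub_distrib]
    refine Finset.sum_congr rfl fun t _ => ?_
    rw [Pi.sub_apply, B7Eq78Linearization.conjR_sub]
  -- (3) right inverse, current bound, `ℓ¹ → ℓ¹` bound, fibre defect
  obtain ⟨H, hTH, hH⟩ := exists_rightInverse_modelAvg_T3 F n K U₀ hε₀ (by linarith) hU₀ T hT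
  have hJ : ∀ Z, |Λ Z| ≤ ε₀ * (((F.L : ℝ) ^ (K - n)) ^ 3)⁻¹ * ∑ b, ‖Z b‖ := fun Z => by
    rw [hΛ Z]; exact abs_lin_le_of_divSmall_T3 F n K U₀ hreg.divSmall Z
  have hTl1 : ∀ Z, ∑ c, ‖T Z c‖ ≤ 2 * (F.L : ℝ) ^ (K - n) * ∑ b, ‖Z b‖ := fun Z => by
    have := sum_norm_modelAvg_le hsites hV₀ T hT Z; rwa [hLF] at this
  have hYrel : ∀ b : PBond (F.P K) 0, ((unitsField (toUField U) b : (Matrix (Fin 2) (Fin 2) ℂ)ˣ) : Matrix (Fin 2) (Fin 2) ℂ)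
      = (1 + Y b) * ((unitsField (toUField U₀) b : (Matrix (Fin 2) (Fin 2) ℂ)ˣ) : Matrix (Fin 2) (Fin 2) ℂ) := by
    intro b
    have hu : star (U₀ b : Matrix (Fin 2) (Fin 2) ℂ) * (U₀ b : Matrix (Fin 2) (Fin 2) ℂ) = 1 :=
      Matrix.mem_unitaryGroup_iff'.mp (Matrix.specialUnitaryGroup_le_unitaryGroup (U₀ b).2)
    show (U b : Matrix (Fin 2) (Fin 2) ℂ) = (1 + Y b) * (U₀ b : Matrix (Fin 2) (Fin 2) ℂ)
    rw [hYU, add_sub_cancel, mul_assoc, hu, mul_one]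
  have hnδ : ((F.P K).L : ℝ) ^ (K - n) * δ ≤ 1 := by rw [hLF]; nlinarith only [hδn, hn0, hδ0]
  have hF : ∑ c : PBond (F.P K) (K - n), ‖T Y c‖ ≤ 2 * ((F.L : ℝ) ^ (K - n)) ^ 2 * ∑ b : PBond (F.P K) 0, ‖Y b‖ ^ 2 := by
    have hc : ∀ c : PBond (F.P K) (K - n), ‖T Y c‖ ≤ ((F.L : ℝ) ^ (K - n)) ^ 2 *
        (∑ r : Fin (F.P K).d → Fin ((F.P K).L ^ (K - n)), ‖Y ⟨Site.fibreSite 0 (K - n) c.src r, c.dir⟩‖ ^ 2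
          + ∑ r : Fin (F.P K).d → Fin ((F.P K).L ^ (K - n)), ‖Y ⟨Site.fibreSite 0 (K - n) (runSite c.src c.dir 1) r, c.dir⟩‖ ^ 2) := by
      intro c
      rw [hT]
      have h1 := norm_covLineSum_le_of_modelFibre (P := F.P K) (k := K - n) hYrel hV₀ hδ hnδ c.dir
        (fun r => holT (unitsField (toUField U₀)) (Site.fibreSite 0 (K - n) c.src fun _ => ⟨0, pow_pos (F.P K).L_pos (K - n)⟩) (treeWord fun ν => ((r ν : ℕ) : ℤ)))
        (fun r => holT_mem hV₀ _ _) (fun r => Site.fibreSite 0 (K - n) c.src r) (hfib c)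
      rw [hLF] at h1
      have h2 := sum_sum_normSq_line_le (P := F.P K) (k := K - n) hsites Y c.src c.dir
      rw [hLF] at h2
      refine h1.trans ?_
      rw [sq, mul_assoc]
      exact mul_le_mul_of_nonneg_left h2 hn0.le
    refine (Finset.sum_le_sum fun c _ => hc c).trans ?_
    rw [← Finset.mul_sum, sum_pair_normSq_eq (P := F.P K) (k := K - n) hsites Y]
    ring_nf
    rfl
  -- (4) the `𝔰𝔲(2)` projection data
  have hYh : ∀ b : PBond (F.P K) 0, ‖Y b - ((1 / 2 : ℂ) • (Y b - (Y b)ᴴ) - ((((1 / 2 : ℂ) • (Y b - (Y b)ᴴ)).trace / 2) • (1 : Matrix (Fin 2) (Fin 2) ℂ)))‖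
      ≤ (1 / 2) * ‖Y b‖ ^ 2 := by
    intro b
    have hW : Y b = ((U b * (U₀ b)⁻¹ : Matrix.specialUnitaryGroup (Fin 2) ℂ) : Matrix (Fin 2) (Fin 2) ℂ) - 1 := by rw [hYU]; rfl
    rw [hW]
    exact norm_sub_proj_le_of_su2 (U b * (U₀ b)⁻¹)
  have hEL' : ∀ Z : PBond (F.P K) 0 → Matrix (Fin 2) (Fin 2) ℂ,
      (∀ b, ((1 / 2 : ℂ) • (Z b - (Z b)ᴴ) - ((((1 / 2 : ℂ) • (Z b - (Z b)ᴴ)).trace / 2) • (1 : Matrix (Fin 2) (Fin 2) ℂ))) = Z b) → T Z = 0 → Λ Z = 0 := by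
    intro Z hZ hTZ
    refine hEL Z (fun b => ?_) hTZ
    constructor
    · rw [← hZ b]; exact Prop7GrowthAssembly.conjTranspose_proj (Z b)
    · rw [← hZ b]; exact Prop7GrowthAssembly.trace_proj (Z b)
  -- (5) the spine
  have hsp := growth_of_growthModLin_proj Λ T H hΛsub hTsub hTH (by positivity) hH
    (fun X : Matrix (Fin 2) (Fin 2) ℂ => (1 / 2 : ℂ) • (X - Xᴴ) - ((((1 / 2 : ℂ) • (X - Xᴴ)).trace / 2) • (1 : Matrix (Fin 2) (Fin 2) ℂ)))
    (fun X : Matrix (Fin 2) (Fin 2) ℂ => (1 / 2 : ℂ) • (X - Xᴴ) - ((((1 / 2 : ℂ) • (X - Xᴴ)).trace / 2) • (1 : Matrix (Fin 2) (Fin 2) ℂ)))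
    (modelAvg_proj_comm U₀ T hT) (fun Z c => proj_proj (T Z c)) proj_sub proj_proj norm_proj_le hEL' (by positivity) hJ (by positivity) hTl1 Y hYh hF hG
  -- (6) the arithmetic of the constants
  have hS0 : 0 ≤ ∑ b : PBond (F.P K) 0, ‖Y b‖ ^ 2 := Finset.sum_nonneg fun _ _ => sq_nonneg _
  set m : ℝ := (F.L : ℝ) ^ (K - n) with hm
  have hcoef : (1 / 1200) * (m ^ 2)⁻¹ ≤ (1 / 600) * (m ^ 2)⁻¹
      - ε₀ * (m ^ 3)⁻¹ * (2 * (2 * m⁻¹) * (2 * m ^ 2 + 2 * m / 2) + 1 / 2) := by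
    rw [show ε₀ * (m ^ 3)⁻¹ * (2 * (2 * m⁻¹) * (2 * m ^ 2 + 2 * m / 2) + 1 / 2) = ε₀ * (8 * (m ^ 2)⁻¹ + (9 / 2) * (m ^ 3)⁻¹) by
      field_simp; ring]
    have h3 : (m ^ 3)⁻¹ ≤ (m ^ 2)⁻¹ := by
      apply inv_anti₀ (by positivity)
      calc m ^ 2 = m ^ 2 * 1 := (mul_one _).symm
        _ ≤ m ^ 2 * m := mul_le_mul_of_nonneg_left hn1 (by positivity)
        _ = m ^ 3 := by ring
    have h2 : (0 : ℝ) < (m ^ 2)⁻¹ := by positivity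
    nlinarith [h3, h2, hε₀, hε₀1]
  nlinarith [hsp, hcoef, hS0]

end Summit.QuantumFields.YangMills.Theorems.Prop7ModelGrowth

end
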